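import Summits.ResolutionOfSingularities.ResolutionOfSingularities.Theorems.HomologicalConductorNoZenoExcCurveLift
import Summits.ResolutionOfSingularities.ResolutionOfSingularities.Theorems.HomologicalConductorNoZenoFirstKindGerm
import Summits.ResolutionOfSingularities.ResolutionOfSingularities.Theorems.HomologicalConductorNoZenoPointBlowupRegularPoint
import Literature.AlgebraicGeometry.Resolution.ExceptionalCurvesLocalizedResolution
import Literature.AlgebraicGeometry.Resolution.BlowupExceptionalFibreNontrivial
import Literature.AlgebraicGeometry.Resolution.PermissibleCentres
import HarnessLib

/-!
# Crux `NoZenoR` (stmt-ResolutionOfSingularities-19943) — the first-kind clause (F) of Lipman (27.3)/(4.1):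
# TERMINATION COUNT, FIRST-KIND TRANSPORT and the ASSEMBLY modulo the one-step descent

Route `ResolutionOfSingularities/HomologicalConductor` (cell decomp-res, hand leafhand-res-homologicalconduct-16 g3).
OURS: AI-written bookkeeping over tree theorems, weaker than expert review; nothing here is a statement of the
manuscript under review (Hironaka 2017).  SUPPORT level, counted 0.  Def-free, no new named facts.

The clause (F) is the hypothesis `hF` of `…NoZenoRCriterionM.isMinimalResolution_iff_criterionM_of_27_1_4_1`:
«a NON-isomorphic `S`-morphism `h : X → Y` from a desingularization `π : X → Spec S` to another desingularization
`g : Y → Spec S` forces an integral exceptional curve OF THE FIRST KIND on `X`, `h⁰(𝓘_η²) = 3·h⁰(𝓘_η)`» — Zariski's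
factorisation of `h` into point blow-ups read at the last blow-up (Lipman p. 277).  This file proves (F) MODULO the
one-step descent «`¬ IsIso h` ⇒ `h` factors through the blowing up of `Y` at a closed point `y` with two-dimensional
local ring, the blown-up surface being again a desingularization» (binder `hstep`; sibling hand 18 g1: non-iso locus +
FactorStep′ + blow-up stage), by induction on the number of integral exceptional curves:

* (c1) `ncard_excCurvePoints_le_of_comp` — along an `S`-morphism of desingularizations the number of integral
  exceptional curves can only grow upstairs (every curve downstairs lifts, tree `ExcCount.exists_mem_excCurvePoints_apply_eq`);
* (c2) `exists_mem_excCurvePoints_blowup_point`, `ncard_excCurvePoints_blowup_point` — the blowing up of a closed point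
  with two-dimensional (regular) local ring ADDS an integral exceptional curve: the generic point of the exceptional
  fibre (`PointBlowup.exists_primeDivisorIdeal_eq_comap_vanishingIdeal`, `IsBlowup.nontrivial_preimage_singleton`);
* (d1) `exists_firstKind_blowup_point` — that curve is OF THE FIRST KIND (`PointBlowup.h0_comap_vanishingIdeal_point_sq_eq_three_mul`);
* (d2) `exists_firstKind_of_iso` — first-kind curves transport along an `S`-isomorphism;
* (A) `firstKindClause_of_step` — (F) from `hstep`, by induction on `#excCurvePoints π − #excCurvePoints g`.

No crux or summit statement is proved here.
-/

noncomputable section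

-- single-problem summit: the doubled namespace component `ResolutionOfSingularities` is forced
set_option linter.dupNamespace false

open CategoryTheory AlgebraicGeometry TopologicalSpace Topology IsLocalRing
open Literature.AlgebraicGeometry.Resolution Scheme.IdealSheafData

namespace Summit.ResolutionOfSingularities.ResolutionOfSingularities.Theorems.NoZeno.ExcCount.FirstKind

variable {S : Type} [CommRing S] [IsNoetherianRing S] [IsLocalRing S] [IsDomain S]

/-! ## Closed points of a proper scheme over the local base -/

omit [IsNoetherianRing S] [IsDomain S] in
/-- A closed point of a proper `S`-scheme lies over the closed point of the local ring `S` (proper maps are closed,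
and the closed point is the only closed point of `Spec S`). [folklore] -/
theorem base_eq_closedPoint_of_isClosed {Y : Scheme.{0}} (g : Y ⟶ Spec (.of S)) [IsProper g]
    {y : Y} (hy : IsClosed ({y} : Set Y)) : g.base y = closedPoint S := by
  have himg : IsClosed ({g.base y} : Set (Spec (.of S))) := by
    have := g.isClosedMap _ hy
    rwa [Set.image_singleton] at this
  have hmax := (PrimeSpectrum.isClosed_singleton_iff_isMaximal (g.base y)).mp himg
  exact PrimeSpectrum.ext (IsLocalRing.eq_maximalIdeal hmax)

/-! ## (c1) Exceptional curves only multiply upstairs -/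

/-- **(c1) The exceptional-curve count grows along an `S`-morphism of desingularizations.**  For `S` a Noetherian
local domain of Krull dimension `2`, `g : Y → Spec S` a desingularization and `h : X → Y` with `h ≫ g` a
desingularization, `#excCurvePoints g ≤ #excCurvePoints (h ≫ g)`: every integral exceptional curve of `g` is the
image of one of `h ≫ g` (tree `ExcCount.exists_mem_excCurvePoints_apply_eq`), and a choice of lifts is injective.
[cite: Lipman1969, Section 10 (p. 212)] -/
theorem ncard_excCurvePoints_le_of_comp (h2 : ringKrullDim S = 2) {X Y : Scheme.{0}}
    (g : Y ⟶ Spec (.of S)) (h : X ⟶ Y) (hg : IsResolution g) (hh : IsResolution (h ≫ g)) :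
    (excCurvePoints g).ncard ≤ (excCurvePoints (h ≫ g)).ncard := by
  classical
  haveI : IsIntegral X := hh.isIntegral_source
  haveI : IsIntegral Y := hg.isIntegral_source
  have hlift : ∀ η ∈ excCurvePoints g, ∃ x ∈ excCurvePoints (h ≫ g), h.base x = η := fun η hη =>
    exists_mem_excCurvePoints_apply_eq g h h2 hh hg hη
  choose! ℓ hℓmem hℓeq using hlift
  refine Set.ncard_le_ncard_of_injOn ℓ (fun η hη => hℓmem η hη) (fun η hη η' hη' heq => ?_)
    (hh.excCurvePoints_finite h2)
  rw [← hℓeq η hη, ← hℓeq η' hη', heq]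

/-! ## (c2) The blowing up of a closed point adds an exceptional curve -/

/-- **The exceptional curve of a point blow-up of a desingularization.**  For `g : Y → Spec S` a desingularization of
the two-dimensional Noetherian local domain `S`, `y ∈ Y` a closed point with `dim 𝒪_{Y,y} = 2` and `b : Y₁ → Y` a
blowing up of `y` (reduced) with `b ≫ g` again a desingularization: the generic point `ε` of the exceptional fibre
`b⁻¹{y}` is an integral exceptional curve of `b ≫ g` — over the closed point, of height `≤ 1` on the desingularization
`b ≫ g` and `≥ 1` because the fibre has a second point (`IsBlowup.nontrivial_preimage_singleton`) — with
`closure {ε} = b⁻¹{y}` and `𝓘_ε = 𝓘_{y}·𝒪_{Y₁}` (`PointBlowup.exists_primeDivisorIdeal_eq_comap_vanishingIdeal`).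
[cite: Liu2002, Thm. 8.1.19 (b)] -/
theorem exists_mem_excCurvePoints_blowup_point (h2 : ringKrullDim S = 2) {Y : Scheme.{0}}
    (g : Y ⟶ Spec (.of S)) (hg : IsResolution g) {y : Y} (hy : IsClosed ({y} : Set Y))
    (hy2 : ringKrullDim (Y.presheaf.stalk y) = 2) {Y₁ : Scheme.{0}} (b : Y₁ ⟶ Y)
    (hb : IsBlowup b (vanishingIdeal ⟨{y}, hy⟩)) (hbg : IsResolution (b ≫ g)) :
    ∃ ε ∈ excCurvePoints (b ≫ g), closure {ε} = b.base ⁻¹' {y} ∧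
      primeDivisorIdeal ε = (vanishingIdeal ⟨{y}, hy⟩).comap b := by
  haveI : IsIntegral Y := hg.isIntegral_source
  haveI : IsIntegral Y₁ := hbg.isIntegral_source
  haveI : IsProper g := hg.isProper
  haveI : IsLocallyNoetherian Y := LocallyOfFiniteType.isLocallyNoetherian g
  haveI : IsRegularLocalRing (Y.presheaf.stalk y) := hg.isRegular y
  have hne : maximalIdeal (Y.presheaf.stalk y) ≠ ⊥ := by
    intro hbot
    have h0 : ringKrullDim (Y.presheaf.stalk y) = 0 :=
      ringKrullDim_eq_zero_of_isField ((isField_iff_maximalIdeal_eq).mpr hbot)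
    rw [hy2] at h0
    exact absurd h0 (by decide)
  obtain ⟨ε, hcl, hId⟩ :=
    PointBlowup.exists_primeDivisorIdeal_eq_comap_vanishingIdeal hg.isRegular y hy hb hne
  have hεy : b.base ε = y := by
    have : ε ∈ b.base ⁻¹' {y} := hcl ▸ subset_closure (Set.mem_singleton ε)
    exact this
  have hgy : g.base y = closedPoint S := base_eq_closedPoint_of_isClosed g hy
  have hover : (b ≫ g).base ε = closedPoint S := by
    rw [Scheme.Hom.comp_apply, hεy, hgy]
  refine ⟨ε, ⟨hover, le_antisymm (hbg.height_le_one_of_base_eq_closedPoint h2 hover) ?_⟩, hcl, hId⟩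
  -- height `≥ 1`: a second point of the fibre is a proper specialisation of `ε`
  obtain ⟨p, hp, hpε⟩ :=
    (hb.nontrivial_preimage_singleton y (stalkIdeal_vanishingIdeal_singleton hy) hy2.ge).exists_ne ε
  have hp' : p ∈ closure {ε} := by rw [hcl]; exact hp
  have hsp : ε ⤳ p := specializes_iff_mem_closure.mpr hp'
  have hlt : p < ε := lt_iff_le_not_ge.mpr ⟨Scheme.le_iff_specializes.mpr hsp, fun hge =>
    hpε ((Scheme.le_iff_specializes.mp hge).antisymm hsp).eq⟩
  exact le_trans (by simp) (Order.height_add_one_le hlt)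

/-- **(c2) A point blow-up adds an integral exceptional curve**: in the situation of
`exists_mem_excCurvePoints_blowup_point`, `#excCurvePoints g + 1 ≤ #excCurvePoints (b ≫ g)` — the lifts of the old
curves (`ExcCount.exists_mem_excCurvePoints_apply_eq`) map to NON-closed points of `Y`, the new curve maps to the
closed point `y`. [cite: Lipman1969, Section 10 (p. 212)] -/
theorem ncard_excCurvePoints_blowup_point (h2 : ringKrullDim S = 2) {Y : Scheme.{0}}
    (g : Y ⟶ Spec (.of S)) (hg : IsResolution g) {y : Y} (hy : IsClosed ({y} : Set Y))
    (hy2 : ringKrullDim (Y.presheaf.stalk y) = 2) {Y₁ : Scheme.{0}} (b : Y₁ ⟶ Y)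
    (hb : IsBlowup b (vanishingIdeal ⟨{y}, hy⟩)) (hbg : IsResolution (b ≫ g)) :
    (excCurvePoints g).ncard + 1 ≤ (excCurvePoints (b ≫ g)).ncard := by
  classical
  haveI : IsIntegral Y := hg.isIntegral_source
  haveI : IsIntegral Y₁ := hbg.isIntegral_source
  have hfin : (excCurvePoints (b ≫ g)).Finite := hbg.excCurvePoints_finite h2
  -- lifts of the old curves
  have hlift : ∀ η ∈ excCurvePoints g, ∃ x ∈ excCurvePoints (b ≫ g), b.base x = η := fun η hη =>
    exists_mem_excCurvePoints_apply_eq g b h2 hbg hg hη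
  choose! ℓ hℓmem hℓeq using hlift
  have hinj : Set.InjOn ℓ (excCurvePoints g) := fun η hη η' hη' heq => by
    rw [← hℓeq η hη, ← hℓeq η' hη', heq]
  have hLsub : ℓ '' excCurvePoints g ⊆ excCurvePoints (b ≫ g) := by
    rintro _ ⟨η, hη, rfl⟩
    exact hℓmem η hη
  -- the new curve
  obtain ⟨ε, hε, hcl, -⟩ := exists_mem_excCurvePoints_blowup_point h2 g hg hy hy2 b hb hbg
  have hεy : b.base ε = y := by
    have : ε ∈ b.base ⁻¹' {y} := hcl ▸ subset_closure (Set.mem_singleton ε)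
    exact this
  have hεL : ε ∉ ℓ '' excCurvePoints g := by
    rintro ⟨η, hη, hηε⟩
    have hηy : η = y := by rw [← hℓeq η hη, hηε, hεy]
    have h1 : Order.height η = 1 := hη.2
    rw [hηy, Scheme.height_of_isClosed hy] at h1
    exact zero_ne_one h1
  have hsub : insert ε (ℓ '' excCurvePoints g) ⊆ excCurvePoints (b ≫ g) :=
    Set.insert_subset hε hLsub
  calc (excCurvePoints g).ncard + 1
      = (ℓ '' excCurvePoints g).ncard + 1 := by rw [hinj.ncard_image]
    _ = (insert ε (ℓ '' excCurvePoints g)).ncard := by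
        rw [Set.ncard_insert_of_notMem hεL (hfin.subset hLsub)]
    _ ≤ (excCurvePoints (b ≫ g)).ncard := Set.ncard_le_ncard hsub hfin

/-! ## (d1) The new curve is of the first kind -/

/-- **(d1) The exceptional curve of a point blow-up of a desingularization is OF THE FIRST KIND**: in the situation of
`exists_mem_excCurvePoints_blowup_point` there is `ε ∈ excCurvePoints (b ≫ g)` with
`h0 (b ≫ g) (𝓘_ε ^ 2) = 3 * h0 (b ≫ g) 𝓘_ε` — `𝓘_ε = 𝓘_{y}·𝒪_{Y₁}` and the two-chart computation
`PointBlowup.h0_comap_vanishingIdeal_point_sq_eq_three_mul` (`(F·F) = −h⁰(F)` in Lipman's dictionary (13.1) d)).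
[cite: Lipman1969, Theorem (27.1) (p. 275) and p. 277] -/
theorem exists_firstKind_blowup_point (h2 : ringKrullDim S = 2) {Y : Scheme.{0}}
    (g : Y ⟶ Spec (.of S)) (hg : IsResolution g) {y : Y} (hy : IsClosed ({y} : Set Y))
    (hy2 : ringKrullDim (Y.presheaf.stalk y) = 2) {Y₁ : Scheme.{0}} (b : Y₁ ⟶ Y)
    (hb : IsBlowup b (vanishingIdeal ⟨{y}, hy⟩)) (hbg : IsResolution (b ≫ g)) :
    ∃ ε ∈ excCurvePoints (b ≫ g),
      h0 (b ≫ g) (primeDivisorIdeal ε ^ 2) = 3 * h0 (b ≫ g) (primeDivisorIdeal ε) := by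
  haveI : IsIntegral Y := hg.isIntegral_source
  haveI : IsIntegral Y₁ := hbg.isIntegral_source
  haveI : IsProper g := hg.isProper
  haveI : IsLocallyNoetherian Y := LocallyOfFiniteType.isLocallyNoetherian g
  haveI : IsRegularLocalRing (Y.presheaf.stalk y) := hg.isRegular y
  obtain ⟨ε, hε, -, hId⟩ := exists_mem_excCurvePoints_blowup_point h2 g hg hy hy2 b hb hbg
  refine ⟨ε, hε, ?_⟩
  rw [hId]
  exact PointBlowup.h0_comap_vanishingIdeal_point_sq_eq_three_mul g b y hy hy2 hb

/-! ## (d2) Transport of first-kind curves along an `S`-isomorphism -/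

/-- **(d2) First-kind exceptional curves transport along an `S`-isomorphism of desingularizations**: for
`π : X → Spec S` a desingularization of the two-dimensional Noetherian local domain `S`, `e : X ⟶ Y₁` an isomorphism
over `Spec S` (`e ≫ g₁ = π`) and `ε ∈ excCurvePoints g₁` of the first kind, the point `η` of `X` over `ε` is an
integral exceptional curve of `π` of the first kind (`e*𝓘_ε = 𝓘_η` along the open immersion `e`,
`ExcCount.comap_primeDivisorIdeal_of_isOpenImmersion`; `h⁰` is unchanged, `PointBlowup.h0_comap_of_isOpenImmersion`).
[cite: Lipman1969, Corollary (27.3), proof (p. 277)] -/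
theorem exists_firstKind_of_iso (h2 : ringKrullDim S = 2) {X : Scheme.{0}} {π : X ⟶ Spec (.of S)}
    (hπ : IsResolution π) {Y₁ : Scheme.{0}} (g₁ : Y₁ ⟶ Spec (.of S)) (e : X ⟶ Y₁) [IsIso e]
    (he : e ≫ g₁ = π)
    (hex : ∃ ε ∈ excCurvePoints g₁, h0 g₁ (primeDivisorIdeal ε ^ 2) = 3 * h0 g₁ (primeDivisorIdeal ε)) :
    ∃ η ∈ excCurvePoints π, h0 π (primeDivisorIdeal η ^ 2) = 3 * h0 π (primeDivisorIdeal η) := by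
  obtain ⟨ε, hε, hnum⟩ := hex
  subst he
  have hsurj : Function.Surjective e.base := (Scheme.homeoOfIso (asIso e)).surjective
  have hclosed : IsClosedMap e.base := (Scheme.homeoOfIso (asIso e)).isClosedMap
  obtain ⟨η, rfl⟩ := hsurj ε
  have hover : (e ≫ g₁).base η = closedPoint S := by
    rw [Scheme.Hom.comp_apply]; exact hε.1
  refine ⟨η, ⟨hover, le_antisymm (hπ.height_le_one_of_base_eq_closedPoint h2 hover) ?_⟩, ?_⟩
  · have := height_apply_le_of_isClosedMap e hclosed η
    rw [hε.2] at this
    exact this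
  · have hsupp : ∀ K : Y₁.IdealSheafData, (K.support : Set Y₁) ⊆ Set.range e.base :=
      fun K z _ => hsurj z
    rw [← comap_primeDivisorIdeal_of_isOpenImmersion e η, ← comap_pow,
      PointBlowup.h0_comap_of_isOpenImmersion g₁ e _ (hsupp _),
      PointBlowup.h0_comap_of_isOpenImmersion g₁ e _ (hsupp _)]
    exact hnum

/-! ## (A) The first-kind clause from the one-step descent -/

/-- **(A) The first-kind clause (F) of Lipman (27.3)/(4.1), modulo the one-step descent.**  Let `S` be a Noetherian
local domain of Krull dimension `2` and `π : X → Spec S` a desingularization.  ASSUME the one-step descent `hstep`: every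
NON-isomorphic `S`-morphism `h : X → Y` to a desingularization `g : Y → Spec S` factors as `h = h₁ ≫ b` through a
blowing up `b : Y₁ → Y` of a closed point `y` with `dim 𝒪_{Y,y} = 2`, with `b ≫ g` again a desingularization (Stacks
0C5H + the universal property of blowing up; sibling files).  THEN every non-isomorphic `S`-morphism `h : X → Y` to a
desingularization forces an integral exceptional curve of `π` OF THE FIRST KIND: `∃ η ∈ excCurvePoints π,
h0 π (𝓘_η ^ 2) = 3 * h0 π 𝓘_η` — the literal binder `hF` of
`…NoZenoRCriterionM.isMinimalResolution_iff_criterionM_of_27_1_4_1`.  Proof: induction on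
`#excCurvePoints π − #excCurvePoints g` (finite, (c1)); each descent step raises `#excCurvePoints g` by one (c2), so
some `h_n : X → Y_n` is an isomorphism, and the exceptional curve of the last blow-up is of the first kind (d1),
transported to `X` (d2).  [cite: Lipman1969, Corollary (27.3), proof (p. 277): "the morphism is a product of quadratic
transformations (Theorem (4.1)); the exceptional curve of the last one has (E²) = −h⁰(E)"];
[cite: StacksProject, Tag 0C5R] -/
theorem firstKindClause_of_step (h2 : ringKrullDim S = 2) {X : Scheme.{0}} {π : X ⟶ Spec (.of S)}
    (hπ : IsResolution π)
    (hstep : ∀ (Y : Scheme.{0}) (g : Y ⟶ Spec (.of S)) (h : X ⟶ Y), IsResolution g → h ≫ g = π →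
      ¬ IsIso h → ∃ (y : Y) (hy : IsClosed ({y} : Set Y)), ringKrullDim (Y.presheaf.stalk y) = 2 ∧
        ∃ (Y₁ : Scheme.{0}) (b : Y₁ ⟶ Y) (h₁ : X ⟶ Y₁),
          IsBlowup b (vanishingIdeal ⟨{y}, hy⟩) ∧ h₁ ≫ b = h ∧ IsResolution (b ≫ g)) :
    ∀ (Y : Scheme.{0}) (g : Y ⟶ Spec (.of S)) (h : X ⟶ Y), IsResolution g → h ≫ g = π → ¬ IsIso h →
      ∃ η ∈ excCurvePoints π, h0 π (primeDivisorIdeal η ^ 2) = 3 * h0 π (primeDivisorIdeal η) := by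
  suffices H : ∀ (k : ℕ) (Y : Scheme.{0}) (g : Y ⟶ Spec (.of S)) (h : X ⟶ Y), IsResolution g →
      h ≫ g = π → ¬ IsIso h → (excCurvePoints π).ncard ≤ (excCurvePoints g).ncard + k →
      ∃ η ∈ excCurvePoints π, h0 π (primeDivisorIdeal η ^ 2) = 3 * h0 π (primeDivisorIdeal η) from
    fun Y g h hg hh hne => H _ Y g h hg hh hne (Nat.le_add_left _ _)
  intro k
  induction k with
  | zero =>
    intro Y g h hg hh hne hle
    obtain ⟨y, hy, hy2, Y₁, b, h₁, hb, hh₁, hbg⟩ := hstep Y g h hg hh hne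
    have hπ₁ : h₁ ≫ b ≫ g = π := by rw [← Category.assoc, hh₁, hh]
    have hres₁ : IsResolution (h₁ ≫ b ≫ g) := by rw [hπ₁]; exact hπ
    have hc2 := ncard_excCurvePoints_blowup_point h2 g hg hy hy2 b hb hbg
    have hc1 := ncard_excCurvePoints_le_of_comp h2 (b ≫ g) h₁ hbg hres₁
    rw [hπ₁] at hc1
    omega
  | succ k ih =>
    intro Y g h hg hh hne hle
    obtain ⟨y, hy, hy2, Y₁, b, h₁, hb, hh₁, hbg⟩ := hstep Y g h hg hh hne
    have hπ₁ : h₁ ≫ b ≫ g = π := by rw [← Category.assoc, hh₁, hh]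
    have hc2 := ncard_excCurvePoints_blowup_point h2 g hg hy hy2 b hb hbg
    by_cases hiso : IsIso h₁
    · exact exists_firstKind_of_iso h2 hπ (b ≫ g) h₁ hπ₁
        (exists_firstKind_blowup_point h2 g hg hy hy2 b hb hbg)
    · exact ih Y₁ (b ≫ g) h₁ hbg hπ₁ hiso (by omega)

end Summit.ResolutionOfSingularities.ResolutionOfSingularities.Theorems.NoZeno.ExcCount.FirstKind

end
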